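import Mathlib.Analysis.SpecialFunctions.Trigonometric.Bounds
import Mathlib.Analysis.SpecialFunctions.Trigonometric.Deriv
import Literature.NumberTheory.LFunctions.DeBruijnNewmanProofs
import Summits.QuantumFields.BalabanUV.T4Continuum.Spine.NE4.FadingFromRateAnalytic

/-!
# Spine/NE4/FadingFromRateAnalyticGap — the complexification of NE4 in `FadingFromRateAnalytic` is NOT cosmetic: with the REAL NE4 only, coordinatewise
# analyticity with a uniform complex bound allows moduli `age·θ^{age}` — rate `θ⁺`, never `θ`

Cell `pub-balaban-gaps` (YM blitz G2), seat `ne4`, generation 5 (unit `pub-balaban-gaps-ne4-g5`); record `HOME/ne/NE4.md` §5 (R36).  Third companion of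
`Spine/NE4/FadingFromRateAnalytic` (R34: `ExtendsC` + COMPLEX NE4 `ScaleShiftRateC` + `CoordAnalyticC` ⇒ `FadingMemory` at rate `θ` by Cauchy's estimate; its header
records that from the REAL NE4 + analyticity one expects only `θ^{age}·O(age)`, by the unformalised two-constants theorem).  This file shows in the kernel that the
`O(age)` loss is GENUINE, so that hypothesis (i) of (R34) — NE4 on the complex neighbourhood — carries real content:

THE WITNESS `logFamily θ r k (g_0,…,g_k) = θ^k·sin(ω_k·g_0)`, `ω_k = k·log(1∕θ)∕r`, with its entire extension `logFamilyC θ r`: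
 * `ExtendsC` (`extendsC_logFamily`); the REAL NE4 `ScaleShiftRate 2 θ γ (logFamily θ r)` (`scaleShiftRate_logFamily`);
 * `CoordAnalyticC 1 γ r (logFamilyC θ r)` (`coordAnalyticC_logFamily`): on the closed `r`-neighbourhood of the coupling interval `|Im z| ≤ r`, so
   `‖θ^k·sin(ω_k z)‖ ≤ θ^k·e^{ω_k r} = θ^k·θ^{−k} = 1` (the tree's `Literature.NumberTheory.LFunctions.norm_sin_le_exp_abs_im` BY NAME, `pow_mul_exp_logFreq`) — the frequency is tuned EXACTLY to what the uniform bound allows;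
 * yet every admissible `Λ` (`HistLipschitz Λ γ (logFamily θ r)`) has `Λ k 0 ≥ (2∕π)·ω_k·θ^k = (2 log(1∕θ)∕(π r))·k·θ^k` as soon as `π ≤ ω_k γ` (`moduli_lower_logFamily`), so
   `FadingMemory C θ Λ` FAILS for every `C` (`not_fadingMemory_logFamily`) — rate `θ` is NOT available from real NE4 + analyticity;
 * while the explicit moduli `Λ♯ k i = [i = 0]·θ^k ω_k` DO fade at every rate `θ′ ∈ ]θ,1]`: `FadingMemory (log(1∕θ)θ′∕(r(θ′−θ))) θ′ Λ♯` (`fadingMemory_logFamily_of_lt`) — the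
   loss is exactly a factor `age`, i.e. rate `θ⁺`;
 * COROLLARY by (R34)'s headline: the extension violates complex NE4 — `¬ ScaleShiftRateC c θ γ r (logFamilyC θ r)` for every `c` (`not_scaleShiftRateC_logFamily`): on the
   complex neighbourhood the family's scale shift is of size `1`, not `θ^k`.
So the regularity ladder reads, rung by rung and each exact: C^{0,1} → none (R35) · C^{1,1} → `√θ` (R29) · analytic + REAL NE4 → `θ⁺` not `θ` (this file; the matching
upper bound `θ^{age}·O(age)` is the two-constants theorem, not formalised) · analytic + COMPLEX NE4 → `θ` (R34).

HONEST FRAMING: a toy family on the tree's HYPOTHESIS SHAPES; nothing of Bałaban's asserted; NE4 NOT IN PRINT, NOT PROVED; spine PROVED 0∕9 unchanged; NOT the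
continuum limit on ℝ⁴, NOT infinite volume, NOT a mass gap, NOT Clay.
-/

noncomputable section

namespace Summit.QuantumFields.BalabanUV.T4Continuum.Spine.NE4

open Set Metric Real
open Literature.MathematicalPhysics.QuantumFieldTheory.Balaban1983to89
open Literature.MathematicalPhysics.QuantumFieldTheory.Balaban1983to89.FlowStep
open Literature.MathematicalPhysics.QuantumFieldTheory.Balaban1983to89.T4CouplingMatching

/-! ## §1 The witness and its positive properties: real NE4, analyticity with bound `1` -/

/-- The frequency `ω_k = k·log(1∕θ)∕r`. [folklore] -/
def logFreq (θ r : ℝ) (k : ℕ) : ℝ := (k : ℝ) * Real.log (1 / θ) / r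

/-- THE WITNESS over ℂ: `logFamilyC θ r k (w_0,…,w_k) = θ^k·sin(ω_k·w_0)` (entire in `w_0`, constant in the others). [folklore] -/
def logFamilyC (θ r : ℝ) : HBetaC := fun k w => (θ : ℂ) ^ k * Complex.sin ((logFreq θ r k : ℂ) * w 0)

/-- Its real restriction `logFamily θ r k (g_0,…,g_k) = θ^k·sin(ω_k·g_0)`. [folklore] -/
def logFamily (θ r : ℝ) : HBeta := fun k v => θ ^ k * Real.sin (logFreq θ r k * v 0)

/-- `logFamilyC` extends `logFamily`. [folklore] -/
theorem extendsC_logFamily (θ r : ℝ) : ExtendsC (logFamily θ r) (logFamilyC θ r) := by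
  intro k v
  simp only [logFamily, logFamilyC, Complex.ofReal_mul, Complex.ofReal_pow, Complex.ofReal_sin]

/-- `|logFamily θ r k v| ≤ θ^k` (`θ ≥ 0`). [folklore] -/
theorem abs_logFamily_le_pow {θ r : ℝ} (hθ0 : 0 ≤ θ) (k : ℕ) (v : Fin (k + 1) → ℝ) : |logFamily θ r k v| ≤ θ ^ k := by
  unfold logFamily
  rw [abs_mul, abs_of_nonneg (pow_nonneg hθ0 k)]
  exact mul_le_of_le_one_right (pow_nonneg hθ0 k) (abs_sin_le_one _)

/-- **THE REAL NE4 AT RATE `θ`**: `ScaleShiftRate 2 θ γ (logFamily θ r)` (`0 ≤ θ ≤ 1`). [folklore] -/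
theorem scaleShiftRate_logFamily {θ r γ : ℝ} (hθ0 : 0 ≤ θ) (hθ1 : θ ≤ 1) : ScaleShiftRate 2 θ γ (logFamily θ r) := by
  intro k w _
  have h1 := abs_logFamily_le_pow (r := r) hθ0 (k + 1) w
  have h2 := abs_logFamily_le_pow (r := r) hθ0 k (Fin.tail w)
  have hθk : θ ^ (k + 1) ≤ θ ^ k := pow_le_pow_of_le_one hθ0 hθ1 (Nat.le_succ k)
  calc |logFamily θ r (k + 1) w - logFamily θ r k (Fin.tail w)|
      ≤ |logFamily θ r (k + 1) w| + |logFamily θ r k (Fin.tail w)| := abs_sub _ _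
    _ ≤ θ ^ (k + 1) + θ ^ k := add_le_add h1 h2
    _ ≤ 2 * θ ^ k := by linarith

/-- On the neighbourhood `Nbhd r γ`, `|Im z| ≤ r`. [folklore] -/
theorem abs_im_le_of_mem_nbhd {r γ : ℝ} {z : ℂ} (hz : z ∈ Nbhd r γ) : |z.im| ≤ r := by
  obtain ⟨t, -, hzt⟩ := hz
  have : |(z - (t : ℂ)).im| ≤ ‖z - (t : ℂ)‖ := Complex.abs_im_le_norm _
  simp only [Complex.sub_im, Complex.ofReal_im, sub_zero] at this
  exact this.trans hzt

/-- **THE FREQUENCY IS TUNED TO THE BOUND**: `θ^k·e^{ω_k r} = 1` (`0 < θ`, `r ≠ 0`). [folklore] -/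
theorem pow_mul_exp_logFreq {θ r : ℝ} (hθ0 : 0 < θ) (hr : r ≠ 0) (k : ℕ) : θ ^ k * Real.exp (logFreq θ r k * r) = 1 := by
  unfold logFreq
  rw [div_mul_cancel₀ _ hr, Real.exp_nat_mul, Real.exp_log (by positivity), ← mul_pow,
    mul_one_div_cancel hθ0.ne', one_pow]

/-- `0 ≤ ω_k` for `0 < θ ≤ 1`, `r > 0`. [folklore] -/
theorem logFreq_nonneg {θ r : ℝ} (hθ0 : 0 < θ) (hθ1 : θ ≤ 1) (hr : 0 < r) (k : ℕ) : 0 ≤ logFreq θ r k := by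
  unfold logFreq
  have : 0 ≤ Real.log (1 / θ) := Real.log_nonneg (by rw [le_div_iff₀ hθ0]; linarith)
  positivity

/-- **ANALYTIC WITH UNIFORM BOUND `1` ON THE NEIGHBOURHOOD**: `CoordAnalyticC 1 γ r (logFamilyC θ r)` (`0 < θ ≤ 1`, `r > 0`): the section in `g_0` is entire with
`‖θ^k sin(ω_k z)‖ ≤ θ^k e^{ω_k|Im z|} ≤ θ^k e^{ω_k r} = 1`; the other sections are constant with modulus `≤ θ^k ≤ 1`. [folklore] -/
theorem coordAnalyticC_logFamily {θ r γ : ℝ} (hθ0 : 0 < θ) (hθ1 : θ ≤ 1) (hr : 0 < r) : CoordAnalyticC 1 γ r (logFamilyC θ r) := by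
  intro k p hp i
  have hω := logFreq_nonneg hθ0 hθ1 hr k
  -- the value bound at any complex point `u` with `|Im u| ≤ r`
  have hval : ∀ u : ℂ, |u.im| ≤ r → ‖(θ : ℂ) ^ k * Complex.sin ((logFreq θ r k : ℂ) * u)‖ ≤ 1 := by
    intro u hu
    rw [norm_mul, norm_pow, Complex.norm_real, Real.norm_eq_abs, abs_of_pos hθ0]
    have h1 := Literature.NumberTheory.LFunctions.norm_sin_le_exp_abs_im ((logFreq θ r k : ℂ) * u)
    rw [Complex.im_ofReal_mul, abs_mul, abs_of_nonneg hω] at h1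
    have h2 : Real.exp (logFreq θ r k * |u.im|) ≤ Real.exp (logFreq θ r k * r) :=
      Real.exp_le_exp.mpr (mul_le_mul_of_nonneg_left hu hω)
    calc θ ^ k * ‖Complex.sin ((logFreq θ r k : ℂ) * u)‖ ≤ θ ^ k * Real.exp (logFreq θ r k * r) :=
          mul_le_mul_of_nonneg_left (h1.trans h2) (pow_nonneg hθ0.le k)
      _ = 1 := pow_mul_exp_logFreq hθ0 hr.ne' k
  refine ⟨univ, isOpen_univ, subset_univ _, ?_, ?_⟩
  · refine (Differentiable.differentiableOn ?_)
    by_cases hi : i = 0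
    · subst hi
      simp only [logFamilyC, Function.update_self]
      exact (differentiable_const _).mul (Complex.differentiable_sin.comp ((differentiable_const _).mul differentiable_id))
    · simp only [logFamilyC, Function.update_of_ne (Ne.symm hi)]
      exact differentiable_const _
  · intro z hz
    by_cases hi : i = 0
    · subst hi
      simp only [logFamilyC, Function.update_self]
      exact hval z (abs_im_le_of_mem_nbhd hz)
    · simp only [logFamilyC, Function.update_of_ne (Ne.symm hi)]
      refine hval _ ?_
      rw [Complex.ofReal_im, abs_zero]; exact hr.le

/-! ## §2 The admissible moduli carry the factor `age`: no rate `θ` -/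

/-- **EVERY ADMISSIBLE MODULUS IS `≥ (2∕π)·ω_k·θ^k` IN THE OLDEST COUPLING** once `π ≤ ω_k·γ` (so that the test couplings `π∕(2ω_k) < π∕ω_k ≤ γ` lie in the box):
values `θ^k·sin(π∕2) = θ^k` and `θ^k·sin π = 0` at distance `π∕(2ω_k)`. [folklore] -/
theorem moduli_lower_logFamily {θ r γ : ℝ} (hθ0 : 0 < θ) {Λ : ℕ → ℕ → ℝ} (hL : HistLipschitz Λ γ (logFamily θ r)) {k : ℕ}
    (hω : 0 < logFreq θ r k) (hk : π ≤ logFreq θ r k * γ) : 2 / π * logFreq θ r k * θ ^ k ≤ Λ k 0 := by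
  set ω : ℝ := logFreq θ r k with hωdef
  have hθk : 0 < θ ^ k := pow_pos hθ0 k
  have hγ : π / ω ≤ γ := by rw [div_le_iff₀ hω]; linarith [mul_comm ω γ]
  set p : Fin (k + 1) → ℝ := Function.update (fun _ => γ) 0 (π / (2 * ω)) with hp
  set q : Fin (k + 1) → ℝ := Function.update (fun _ => γ) 0 (π / ω) with hq
  have hγpos : 0 < γ := lt_of_lt_of_le (by positivity) hγ
  have hbox : ∀ x : ℝ, 0 < x → x ≤ γ → Function.update (fun _ : Fin (k + 1) => γ) 0 x ∈ Box γ k := fun x hx0 hxγ => by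
    rw [mem_box]; intro j
    by_cases hj : j = 0
    · subst hj; simpa using ⟨hx0, hxγ⟩
    · rw [Function.update_of_ne hj]; exact ⟨hγpos, le_rfl⟩
  have hpq : π / (2 * ω) ≤ π / ω := by
    rw [div_le_div_iff_of_pos_left (by positivity) (by positivity) hω]; linarith
  have hpb : p ∈ Box γ k := hbox _ (by positivity) (hpq.trans hγ)
  have hqb : q ∈ Box γ k := hbox _ (by positivity) hγ
  have h := hL k p q hpb hqb
  have hωp : ω * p 0 = π / 2 := by simp only [hp, Function.update_self]; field_simp
  have hωq : ω * q 0 = π := by simp only [hq, Function.update_self]; field_simp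
  have hval : |logFamily θ r k p - logFamily θ r k q| = θ ^ k := by
    simp only [logFamily, ← hωdef, hωp, hωq, Real.sin_pi_div_two, Real.sin_pi, mul_one, mul_zero, sub_zero]
    exact abs_of_nonneg hθk.le
  have hsum : ∑ i : Fin (k + 1), Λ k i * |p i - q i| = Λ k 0 * (π / (2 * ω)) := by
    rw [Finset.sum_eq_single (0 : Fin (k + 1))]
    · simp only [hp, hq, Function.update_self, Fin.val_zero]
      rw [show π / (2 * ω) - π / ω = -(π / (2 * ω)) by field_simp; ring, abs_neg, abs_of_pos (by positivity)]
    · intro j _ hj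
      simp [hp, hq, Function.update_of_ne hj]
    · simp
  rw [hval, hsum] at h
  -- `θ^k ≤ Λ k 0 · π/(2ω)` ⇒ `(2/π) ω θ^k ≤ Λ k 0`
  have h' : 2 / π * ω * θ ^ k ≤ 2 / π * ω * (Λ k 0 * (π / (2 * ω))) := mul_le_mul_of_nonneg_left h (by positivity)
  calc 2 / π * ω * θ ^ k ≤ 2 / π * ω * (Λ k 0 * (π / (2 * ω))) := h'
    _ = Λ k 0 := by field_simp

/-- **NO RATE `θ` FROM THE REAL NE4 + ANALYTICITY**: for `0 < θ < 1`, `γ > 0`, `r > 0`, every `Λ` with `HistLipschitz Λ γ (logFamily θ r)` and every `C`: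
`¬ FadingMemory C θ Λ` (`Λ k 0 ≥ c₁·k·θ^k` for large `k` is incompatible with `Λ k 0 ≤ C·θ^k`). [folklore] -/
theorem not_fadingMemory_logFamily {θ r γ C : ℝ} {Λ : ℕ → ℕ → ℝ} (hθ0 : 0 < θ) (hθ1 : θ < 1) (hγ : 0 < γ) (hr : 0 < r)
    (hL : HistLipschitz Λ γ (logFamily θ r)) : ¬ FadingMemory C θ Λ := by
  intro hF
  have hLpos : 0 < Real.log (1 / θ) := Real.log_pos (by rw [lt_div_iff₀ hθ0]; linarith)
  -- a scale `k` with `ω_k γ ≥ π` and `(2/π) ω_k > C`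
  obtain ⟨k, hk⟩ := exists_nat_gt (max (π * r / (Real.log (1 / θ) * γ)) (|C| * π * r / (2 * Real.log (1 / θ))))
  have hk1 : π * r / (Real.log (1 / θ) * γ) < k := lt_of_le_of_lt (le_max_left _ _) hk
  have hk2 : |C| * π * r / (2 * Real.log (1 / θ)) < k := lt_of_le_of_lt (le_max_right _ _) hk
  have hωk : logFreq θ r k = (k : ℝ) * Real.log (1 / θ) / r := rfl
  have hω : 0 < logFreq θ r k := by
    rw [hωk]
    have : (0 : ℝ) < k := lt_of_le_of_lt (by positivity) hk1
    positivity
  have hkπ : π ≤ logFreq θ r k * γ := by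
    rw [hωk]
    rw [div_lt_iff₀ (by positivity)] at hk1
    rw [div_mul_eq_mul_div, le_div_iff₀ hr]
    linarith
  have hlow := moduli_lower_logFamily hθ0 hL hω hkπ
  have hup := (hF k 0 (Nat.zero_le k)).2
  rw [Nat.sub_zero] at hup
  have hθk : 0 < θ ^ k := pow_pos hθ0 k
  -- `(2/π) ω_k ≤ C`, contradicting the choice of `k`
  have h1 : 2 / π * logFreq θ r k ≤ C := le_of_mul_le_mul_right (hlow.trans hup) hθk
  have h2 : C < 2 / π * logFreq θ r k := by
    rw [div_lt_iff₀ (by positivity)] at hk2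
    have hC : C ≤ |C| := le_abs_self C
    rw [hωk, show 2 / π * ((k : ℝ) * Real.log (1 / θ) / r) = (k : ℝ) * (2 * Real.log (1 / θ)) / (π * r) by field_simp,
      lt_div_iff₀ (by positivity)]
    calc C * (π * r) ≤ |C| * (π * r) := mul_le_mul_of_nonneg_right hC (by positivity)
      _ = |C| * π * r := by ring
      _ < (k : ℝ) * (2 * Real.log (1 / θ)) := hk2
  linarith

/-! ## §3 … but every rate `θ′ > θ` IS available: the loss is exactly the factor `age` -/

/-- The explicit moduli of the witness: `Λ♯ k i = [i = 0]·θ^k·ω_k`. [folklore] -/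
def logModuli (θ r : ℝ) : ℕ → ℕ → ℝ := fun k i => if i = 0 then θ ^ k * logFreq θ r k else 0

/-- `HistLipschitz (logModuli θ r) γ (logFamily θ r)` (`θ ≥ 0`; `sin` is 1-Lipschitz). [folklore] -/
theorem histLipschitz_logFamily {θ r γ : ℝ} (hθ0 : 0 ≤ θ) (hω : ∀ k, 0 ≤ logFreq θ r k) :
    HistLipschitz (logModuli θ r) γ (logFamily θ r) := by
  intro k p q _ _
  have hsum : ∑ i : Fin (k + 1), logModuli θ r k i * |p i - q i| = θ ^ k * logFreq θ r k * |p 0 - q 0| := by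
    rw [Finset.sum_eq_single (0 : Fin (k + 1))]
    · simp [logModuli]
    · intro j _ hj
      have : (j : ℕ) ≠ 0 := fun h => hj (Fin.ext h)
      simp [logModuli, this]
    · simp
  rw [hsum]
  unfold logFamily
  rw [← mul_sub, abs_mul, abs_of_nonneg (pow_nonneg hθ0 k), mul_assoc]
  refine mul_le_mul_of_nonneg_left ?_ (pow_nonneg hθ0 k)
  calc |Real.sin (logFreq θ r k * p 0) - Real.sin (logFreq θ r k * q 0)|
      ≤ |logFreq θ r k * p 0 - logFreq θ r k * q 0| := Real.abs_sin_sub_sin_le _ _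
    _ = logFreq θ r k * |p 0 - q 0| := by rw [← mul_sub, abs_mul, abs_of_nonneg (hω k)]

/-- **EVERY RATE `θ′ ∈ ]θ,1]` IS ATTAINED**: `FadingMemory (log(1∕θ)·θ′∕(r(θ′−θ))) θ′ (logModuli θ r)` (`0 < θ < θ′ ≤ 1`, `r > 0`): `k(θ∕θ′)^k ≤ θ′∕(θ′−θ)`. [folklore] -/
theorem fadingMemory_logFamily_of_lt {θ θ' r : ℝ} (hθ0 : 0 < θ) (hlt : θ < θ') (hθ'1 : θ' ≤ 1) (hr : 0 < r) :
    FadingMemory (Real.log (1 / θ) * θ' / (r * (θ' - θ))) θ' (logModuli θ r) := by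
  have hL0 : 0 ≤ Real.log (1 / θ) := Real.log_nonneg (by rw [le_div_iff₀ hθ0]; linarith)
  have hθ'0 : 0 < θ' := hθ0.trans hlt
  intro k i hik
  by_cases hi : i = 0
  · subst hi
    simp only [logModuli, if_true, Nat.sub_zero]
    refine ⟨mul_nonneg (pow_nonneg hθ0.le k) (by unfold logFreq; positivity), ?_⟩
    -- `θ^k · k L / r ≤ (L θ′/(r(θ′−θ))) θ′^k`
    have hx1 : θ / θ' < 1 := (div_lt_one hθ'0).mpr hlt
    have hx0 : 0 ≤ θ / θ' := div_nonneg hθ0.le hθ'0.le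
    -- `k·x^k ≤ Σ_{i<k} x^i ≤ 1/(1−x)` for `x = θ/θ′` (each of the `k` terms `x^0,…,x^{k−1}` dominates `x^k`)
    have hkey : (k : ℝ) * (θ / θ') ^ k ≤ 1 / (1 - θ / θ') := by
      have h1 : (k : ℝ) * (θ / θ') ^ k ≤ ∑ i ∈ Finset.range k, (θ / θ') ^ i := by
        have : ∀ i ∈ Finset.range k, (θ / θ') ^ k ≤ (θ / θ') ^ i := fun i hi =>
          pow_le_pow_of_le_one hx0 hx1.le (Finset.mem_range.mp hi).le
        calc (k : ℝ) * (θ / θ') ^ k = ∑ _i ∈ Finset.range k, (θ / θ') ^ k := by simp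
          _ ≤ ∑ i ∈ Finset.range k, (θ / θ') ^ i := Finset.sum_le_sum this
      refine h1.trans ?_
      rw [Finset.range_eq_Ico]
      simpa using geom_sum_Ico_le_of_lt_one (m := 0) (n := k) hx0 hx1
    rw [div_pow] at hkey
    have hθ'k : 0 < θ' ^ k := pow_pos hθ'0 k
    have e1 : 1 / (1 - θ / θ') = θ' / (θ' - θ) := by
      field_simp
    rw [e1] at hkey
    -- multiply `k θ^k/θ'^k ≤ θ'/(θ'−θ)` by `L/r · θ'^k`
    have := mul_le_mul_of_nonneg_left hkey (by positivity : 0 ≤ Real.log (1 / θ) / r * θ' ^ k)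
    unfold logFreq
    calc θ ^ k * ((k : ℝ) * Real.log (1 / θ) / r) = Real.log (1 / θ) / r * θ' ^ k * ((k : ℝ) * (θ ^ k / θ' ^ k)) := by
          field_simp
      _ ≤ Real.log (1 / θ) / r * θ' ^ k * (θ' / (θ' - θ)) := this
      _ = Real.log (1 / θ) * θ' / (r * (θ' - θ)) * θ' ^ k := by
          have : θ' - θ ≠ 0 := by linarith
          field_simp
  · simp only [logModuli, hi, if_false]
    exact ⟨le_rfl, by positivity⟩

/-! ## §4 Corollary through (R34): the witness violates COMPLEX NE4 -/

/-- **THE EXTENSION VIOLATES COMPLEX NE4**: `¬ ScaleShiftRateC c θ γ r (logFamilyC θ r)` for every `c` (`0 < θ < 1`, `γ > 0`, `r > 0`) — for `c ≥ 0` because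
`FadingFromRateAnalytic.histLipschitz_fadingMemory_of_analytic` would then give moduli fading at rate `θ`, against `not_fadingMemory_logFamily`; for `c < 0` trivially.
So hypothesis (i) of (R34) is exactly what separates rate `θ` from rate `θ⁺`. [folklore] -/
theorem not_scaleShiftRateC_logFamily {θ r γ c : ℝ} (hθ0 : 0 < θ) (hθ1 : θ < 1) (hγ : 0 < γ) (hr : 0 < r) :
    ¬ ScaleShiftRateC c θ γ r (logFamilyC θ r) := by
  intro hS
  rcases le_or_gt 0 c with hc | hc
  · obtain ⟨hL, hF⟩ := histLipschitz_fadingMemory_of_analytic (extendsC_logFamily θ r) hS hc hθ0 hθ1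
      (coordAnalyticC_logFamily hθ0 hθ1.le hr) hr
    exact not_fadingMemory_logFamily hθ0 hθ1 hγ hr hL hF
  · -- `c < 0`: the inequality fails at any complex box history, e.g. the constant history `γ`
    have hw : (fun _ : Fin (0 + 2) => (γ : ℂ)) ∈ CBox r γ (0 + 1) := fun _ => ofReal_mem_nbhd hr.le ⟨hγ, le_rfl⟩
    have h := hS 0 _ hw
    have : c * θ ^ 0 < 0 := by rw [pow_zero, mul_one]; exact hc
    exact absurd (h.trans_lt this) (not_lt.mpr (norm_nonneg _))

end Summit.QuantumFields.BalabanUV.T4Continuum.Spine.NE4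

end
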